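import Summits.NavierStokesRegularity.NavierStokesRegularity.Theorems.TypeILiouvilleTypeIliouvilleLWeakL3VanishingTail
import HarnessLib

/-!
# An `o(|x|⁻¹)` slice has vanishing weak-`L³` lower tail (crux `TypeIliouvilleL`,
# stmt-NavierStokesRegularity-10661, persistent stub S3ᵐ): the `O(|x|⁻¹)` / `o(|x|⁻¹)` dichotomy of
# the weak-`L³` recurrence theorem

Helper file (theorems only, no definition, no named fact, no `sorry`; lands
`--supports stmt-NavierStokesRegularity-10661`). Feeds `…WeakL3VanishingTail`
(`oseenMild_const_of_backward_weakL3_const_of_tail`) with the POINTWISE-DECAY source of a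
vanishing lower tail. The weak-`L³` class is exactly wide enough to hold the `O(|x|⁻¹)` wakes of
steady exterior flows and the tails of Type-I / self-similar profiles — the members Albritton–Barker's
`ε(M)` cannot kill; here:

* `tendsto_cube_mul_meas_lt_of_littleO_inv_norm` — if `‖g(x)‖·‖x‖ → 0` as `‖x‖ → ∞`
  (`∀ ε > 0 ∃ R, ‖x‖ ≥ R → ‖g x‖‖x‖ ≤ ε`), then `s³·vol{s < ‖g‖} → 0` as `s → 0⁺`
  (`{s < ‖g‖} ⊆ B̄(0, ε/s)` for `s < ε/R`); no measurability needed;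
* `oseenMild_const_of_backward_weakL3_const_of_littleO_slice` — a mild bounded ancient solution with
  a uniform weak-`L³` bound of `v(τ_k) − b` along `τ_k → −∞` and ONE slice with
  `‖v(τ_{k₀},x) − b‖ = o(|x|⁻¹)` is the constant `b` on the whole slab. So inside the weak-`L³`
  recurrence class only GENUINE `|x|⁻¹` wakes at EVERY recurrence time can be non-constant.

Nothing here proves S3ᵐ, (L), or anything about Navier–Stokes regularity.
-/

set_option linter.dupNamespace false

namespace Summit.NavierStokesRegularity.NavierStokesRegularity.Theorems

open MeasureTheory Filter Set Function Metric
open scoped ENNReal NNReal Topology RealInnerProductSpace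
open Literature.Analysis Literature.Analysis.FluidPDE

/-- **An `o(|x|⁻¹)` function has vanishing weak-`L³` lower tail.** If `g : ℝ³ → F` satisfies
`‖g x‖ · ‖x‖ ≤ ε` for `‖x‖ ≥ R(ε)`, for every `ε > 0`, then `s³ · vol{x : s < ‖g x‖} → 0` as
`s → 0⁺`: for `0 < s < ε/R(ε)` the superlevel set lies in the ball `B̄(0, ε/s)`, whose volume is
`(ε/s)³ vol B̄₁`. [folklore] -/
theorem tendsto_cube_mul_meas_lt_of_littleO_inv_norm {F : Type*} [NormedAddCommGroup F]
    {g : EuclideanSpace ℝ (Fin 3) → F}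
    (hdecay : ∀ ε : ℝ, 0 < ε → ∃ R : ℝ, 0 < R ∧ ∀ x, R ≤ ‖x‖ → ‖g x‖ * ‖x‖ ≤ ε) :
    Tendsto (fun s : ℝ => ENNReal.ofReal s ^ 3 *
        (volume : Measure (EuclideanSpace ℝ (Fin 3))) {x | s < ‖g x‖}) (𝓝[>] 0) (𝓝 0) := by
  set V₁ : ℝ≥0∞ := (volume : Measure (EuclideanSpace ℝ (Fin 3))) (closedBall 0 1) with hV₁
  have hV : V₁ ≠ ∞ := measure_closedBall_lt_top.ne
  set v₁ : ℝ := V₁.toReal with hv₁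
  have hv₁0 : 0 ≤ v₁ := ENNReal.toReal_nonneg
  rw [ENNReal.tendsto_nhds_zero]
  intro ε' hε'
  -- a real level `δ ∈ (0,1]` with `δ³ v₁ ≤ δ (v₁ + 1) ≤ ε'`
  obtain ⟨δ, hδ0, hδ1, hδε⟩ : ∃ δ : ℝ, 0 < δ ∧ δ ≤ 1 ∧ ENNReal.ofReal (δ * (v₁ + 1)) ≤ ε' := by
    rcases eq_or_ne ε' ∞ with h | h
    · exact ⟨1, one_pos, le_rfl, h ▸ le_top⟩
    · have hε'r : 0 < ε'.toReal := ENNReal.toReal_pos hε'.ne' h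
      refine ⟨min 1 (ε'.toReal / (v₁ + 1)), lt_min one_pos (by positivity), min_le_left _ _, ?_⟩
      calc ENNReal.ofReal (min 1 (ε'.toReal / (v₁ + 1)) * (v₁ + 1))
          ≤ ENNReal.ofReal (ε'.toReal / (v₁ + 1) * (v₁ + 1)) := by
            gcongr
            exact min_le_right _ _
        _ = ε' := by rw [div_mul_cancel₀ _ (by positivity), ENNReal.ofReal_toReal h]
  obtain ⟨R, hR0, hR⟩ := hdecay δ hδ0
  have hmem : Ioo (0 : ℝ) (δ / R) ∈ 𝓝[>] (0 : ℝ) := Ioo_mem_nhdsGT (div_pos hδ0 hR0)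
  filter_upwards [hmem] with s hs
  have hs0 : 0 < s := hs.1
  -- the superlevel set lies in `B̄(0, δ/s)`
  have hsub : {x : EuclideanSpace ℝ (Fin 3) | s < ‖g x‖} ⊆ closedBall 0 (δ / s) := by
    intro x hx
    simp only [mem_setOf_eq] at hx
    rw [mem_closedBall, dist_zero_right]
    rcases lt_or_ge ‖x‖ R with hxR | hxR
    · have h1 : R < δ / s := by
        rw [lt_div_iff₀ hs0]
        have := hs.2
        rw [lt_div_iff₀ hR0] at this
        linarith
      exact (hxR.trans h1).le
    · have h1 := hR x hxR
      rw [le_div_iff₀ hs0]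
      have hx0 : 0 ≤ ‖x‖ := norm_nonneg _
      nlinarith
  calc ENNReal.ofReal s ^ 3 * (volume : Measure (EuclideanSpace ℝ (Fin 3))) {x | s < ‖g x‖}
      ≤ ENNReal.ofReal s ^ 3 * volume (closedBall (0 : EuclideanSpace ℝ (Fin 3)) (δ / s)) := by
        gcongr
    _ = ENNReal.ofReal s ^ 3 * (ENNReal.ofReal ((δ / s) ^ 3) * V₁) := by
        rw [Measure.addHaar_closedBall' volume (0 : EuclideanSpace ℝ (Fin 3))
          (div_nonneg hδ0.le hs0.le), finrank_euclideanSpace_fin]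
    _ = ENNReal.ofReal (δ ^ 3 * v₁) := by
        rw [← ENNReal.ofReal_pow hs0.le, ← mul_assoc, ← ENNReal.ofReal_mul (by positivity),
          ← ENNReal.ofReal_toReal hV, ← ENNReal.ofReal_mul (by positivity)]
        congr 1
        field_simp
        rw [hv₁]
    _ ≤ ENNReal.ofReal (δ * (v₁ + 1)) := by
        refine ENNReal.ofReal_le_ofReal ?_
        have h3 : δ ^ 3 ≤ δ := by
          calc δ ^ 3 = δ * (δ * δ) := by ring
            _ ≤ δ * (1 * 1) := by gcongr
            _ = δ := by ring
        nlinarith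
    _ ≤ ε' := hδε

/-- **Weak-`L³` recurrence with ONE `o(|x|⁻¹)` slice kills a mild bounded ancient solution on the
whole slab.** Let `v` be continuous and uniformly bounded on `(−∞,0) × ℝ³`, weakly divergence free
on every slice and Oseen-mild, with negative times `τ_k → −∞` and a finite `M` such that
`s³ · vol{x : s < ‖v(τ_k,x) − b‖} ≤ M` for all `s > 0` and all `k`. If at ONE index `k₀`
`‖v(τ_{k₀},x) − b‖ · ‖x‖ → 0` as `‖x‖ → ∞`, then `v(t,x) = b` for all `t < 0` and all `x`
(`oseenMild_const_of_backward_weakL3_const_of_tail` +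
`tendsto_cube_mul_meas_lt_of_littleO_inv_norm`). Within the weak-`L³` recurrence class, only fields
carrying a GENUINE `|x|⁻¹` wake at every recurrence time escape.
[cite: AlbrittonBarker2019, Thm 4.1 (arXiv:1811.00502 §4 p. 9)] -/
theorem oseenMild_const_of_backward_weakL3_const_of_littleO_slice
    (v : ℝ → EuclideanSpace ℝ (Fin 3) → EuclideanSpace ℝ (Fin 3)) (b : EuclideanSpace ℝ (Fin 3))
    (hvc : ContinuousOn (uncurry v) (Iio 0 ×ˢ univ))
    (hvK : ∃ K : ℝ, ∀ t < 0, ∀ x, ‖v t x‖ ≤ K)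
    (hvd : ∀ t < 0, IsWeaklyDivFree (v t))
    (hvm : ∀ s t : ℝ, s < t → t < 0 → ∀ x,
      v t x = UnboundedOperators.heatExtension (v s) (t - s) x - oseenDuhamel 1 s v v t x)
    {τ : ℕ → ℝ} {M : ℝ≥0∞} (hM : M < ∞) (hτ : Tendsto τ atTop atBot) (hτ0 : ∀ k, τ k < 0)
    (hwk : ∀ (k : ℕ) (s : ℝ), 0 < s →
      ENNReal.ofReal s ^ 3 *
        (volume : Measure (EuclideanSpace ℝ (Fin 3))) {x | s < ‖v (τ k) x - b‖} ≤ M)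
    {k₀ : ℕ}
    (hdecay : ∀ ε : ℝ, 0 < ε → ∃ R : ℝ, 0 < R ∧ ∀ x : EuclideanSpace ℝ (Fin 3), R ≤ ‖x‖ →
      ‖v (τ k₀) x - b‖ * ‖x‖ ≤ ε) :
    ∀ t < 0, ∀ x, v t x = b :=
  oseenMild_const_of_backward_weakL3_const_of_tail v b hvc hvK hvd hvm hM hτ hτ0 hwk
    (tendsto_cube_mul_meas_lt_of_littleO_inv_norm (g := fun x => v (τ k₀) x - b) hdecay)

end Summit.NavierStokesRegularity.NavierStokesRegularity.Theorems
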